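import Mathlib.Analysis.Calculus.ParametricIntegral
import Literature.NumberTheory.Automorphic.AutomorphicRepsGL
import Literature.NumberTheory.Automorphic.BlockUnipotentDomains
import Literature.NumberTheory.Automorphic.TestFunctionLieDeriv
import HarnessLib

/-!
# Cuspidality is preserved by Lie derivatives: the constant terms of `X φ`, `X₁ ⋯ X_m φ` and `p φ`
# vanish with those of `φ`
(Moeglin–Waldspurger, *Spectral decomposition and Eisenstein series* (1995), I.2.6 and the last
sentence of the proof of Lemma I.2.10: "We obtain the conclusion for all `X` by replacing `φ` by
`δ(X)φ`"; Borel–Jacquet (1979), 4.3 (ii)–4.4)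

Topic `NumberTheory/Automorphic`; a brick of the discharge of the named facts
`AutomorphicRepsGL.siegelGrowthBound_rootShift_of_cuspCondition` (MW Lemma I.2.10, cuspidal case)
and `AutomorphicRepsGL.rapidlyDecreasingOnSiegelSets_of_cuspidal` (MW Cor. I.2.12) for `GL_n` over a
number field `K`. Both bound *all* derivatives `p φ`, `p ∈ ℝ⟨𝔤⟩`, of a cuspidal `φ` on Siegel
sets, and the proof of the bound for `p φ` runs the argument for `φ` with `φ` replaced by `p φ`;
this needs the constant term of `p φ` along the maximal parabolic `P_k` to vanish with that of
`φ`, i.e. differentiation under the integral over the compact quotient `N_k(K)\N_k(𝔸_K)`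
(MW I.2.6: "If `φ` is … smooth, then `φ_P` is … smooth" — the same interchange). We PROVE, for
`φ : GL_n(𝔸_K) → ℂ` left `GL_n(K)`-invariant, smooth in the archimedean variable and right
invariant under an admissible level (hence continuous, `AutomorphicFormsGLContinuous`):

* `glUnipotent_mem_arithmeticSubgroup` — `1 + γ ∈ GL_n(K)` for `γ ∈ 𝔫_k(K)`;
  `IsLeftInvariant.apply_glUnipotent_vadd_mul` — `φ ((1 + (γ + X)) g) = φ ((1 + X) g)`;
  `IsLeftInvariant.exists_forall_norm_apply_glUnipotent_mul_le` — a continuous left-invariant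
  function is bounded on `{(1 + X) g e(s)}`, `X ∈ 𝔫_k(𝔸_K)`, `|s| ≤ 1`, along an archimedean
  one-parameter subgroup `e(s)` (periodicity and the relatively compact Tate domain).
* `CuspConditionGL.lieDeriv` — **if the constant term of `φ` along `P_k` vanishes, so does that of
  `X φ`** for every `X ∈ 𝔤𝔩_n(K_∞)`: `s ↦ ∫_𝓕 φ ((1 + Y) g e^{sX}) dν(Y)` vanishes identically and
  may be differentiated under the integral sign at `s = 0` (Mathlib
  `hasDerivAt_integral_of_dominated_loc_of_deriv_le`; the derivative `(X φ)((1 + Y) g e^{sX})` is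
  bounded uniformly, and every fundamental domain has the finite measure of Tate's);
  `CuspConditionGL.iterLieDeriv`, `CuspConditionGL.applyFree` — hence for all words and all
  `p ∈ ℝ⟨𝔤⟩`.
* The companion closure properties of the hypotheses: `IsRightInvariantUnder.iterLieDeriv_gl`,
  `IsRightInvariantUnder.applyFree_gl`, `IsLeftInvariantUnder.applyFree_gl`, and
  `applyFree_mul_of_isArchSmooth` — **`(q p) φ = q (p φ)` on smooth `φ`** (the word action is an
  algebra action through `U(𝔤)`, `coe_envelopingAction_freeToEnveloping`), the identity by which a
  bound assumed for all derivatives of `φ` is a bound for all derivatives of `p φ`.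

Everything here is proved; no new definition.

## References

* C. Moeglin, J.-L. Waldspurger, *Spectral decomposition and Eisenstein series*, Cambridge Tracts
  in Math. 113 (1995), I.2.6, proof of Lemma I.2.10 (last sentence) [MoeglinWaldspurger1995].
* A. Borel, H. Jacquet, *Automorphic forms and automorphic representations*, Proc. Sympos. Pure
  Math. 33 (1979), Part 1, 4.3 (ii), 4.4 [BorelJacquet1979].
-/

noncomputable section

open scoped MatrixGroups Matrix ContDiff Classical Topology
open NumberField NumberField.mixedEmbedding IsDedekindDomain Filter Set
open _root_.MeasureTheory

namespace Literature.NumberTheory.Automorphic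

variable {n : ℕ} {K : Type} [Field K] [NumberField K]

/-! ### 1. Rational block unipotents and left invariance -/

section Rational

/-- **`1 + γ ∈ GL_n(K)` for `γ ∈ 𝔫_k(K)`**: the block unipotent of a rational block-nilpotent matrix
lies in the arithmetic subgroup `GL_n(K) ≤ GL_n(𝔸_K)` of the datum `gl n K` (the matrix `1 + γ`
with entries in `K`, mapped by `algebraMap K 𝔸_K`). This is the membership behind
`glUnipotent_mem_quotientSubgroup` of `GLnCuspidalSpectrum`, recorded for the smaller subgroup.
Borel–Jacquet 1979, 4.4. [cite: BorelJacquet1979, 4.4] -/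
theorem glUnipotent_mem_arithmeticSubgroup {k : ℕ} {X : blockNilpotent n k (AdeleRing (𝓞 K) K)}
    (hX : X ∈ rationalBlock n k K) :
    glUnipotent n k K (Multiplicative.ofAdd X) ∈ (AdelicGroupData.gl n K).arithmeticSubgroup := by
  classical
  choose x hx using hX
  set Xr : Matrix (Fin n) (Fin n) K := Matrix.of fun i j => x i j with hXr
  have hXr_mem : Xr ∈ blockNilpotent n k K := by
    intro i j hij
    refine X.2 i j ?_
    rw [← hx i j]
    exact (map_ne_zero_iff _ (AdeleRing.algebraMap_injective (𝓞 K) K)).mpr hij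
  refine ⟨unipotentOfBlock n k K (Multiplicative.ofAdd ⟨Xr, hXr_mem⟩), ?_⟩
  refine Units.ext (Matrix.ext fun i j => ?_)
  change algebraMap K (AdeleRing (𝓞 K) K) ((1 + Xr) i j) =
    (1 + (X : Matrix (Fin n) (Fin n) (AdeleRing (𝓞 K) K))) i j
  rw [Matrix.add_apply, Matrix.add_apply, map_add, hXr, Matrix.of_apply, hx i j,
    Matrix.one_apply, Matrix.one_apply]
  split_ifs <;> simp

/-- **Periodicity of `X ↦ φ ((1 + X) g)` under `𝔫_k(K)`** for a left `GL_n(K)`-invariant `φ`: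
`φ ((1 + (γ + X)) g) = φ ((1 + X) g)` (`1 + (γ + X) = (1 + γ)(1 + X)` and `1 + γ ∈ GL_n(K)`).
Borel–Jacquet 1979, 4.4. [cite: BorelJacquet1979, 4.4] -/
theorem IsLeftInvariant.apply_glUnipotent_vadd_mul {k : ℕ}
    {φ : GL (Fin n) (AdeleRing (𝓞 K) K) → ℂ} (hφ : IsLeftInvariant (AdelicGroupData.gl n K) φ)
    (γ : rationalBlock n k K) (X : blockNilpotent n k (AdeleRing (𝓞 K) K))
    (g : GL (Fin n) (AdeleRing (𝓞 K) K)) :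
    φ (unipotentOfBlock n k (AdeleRing (𝓞 K) K) (Multiplicative.ofAdd (γ +ᵥ X)) * g) =
      φ (unipotentOfBlock n k (AdeleRing (𝓞 K) K) (Multiplicative.ofAdd X) * g) := by
  rw [AddSubgroup.vadd_def, vadd_eq_add, ofAdd_add, map_mul, mul_assoc]
  exact hφ _ (glUnipotent_mem_arithmeticSubgroup γ.2) _

/-- `X ↦ 1 + X : 𝔫_k(𝔸_K) → GL_n(𝔸_K)` is continuous (entries and inverse entries `1 ± X`).
[folklore] -/
theorem continuous_unipotentOfBlock_ofAdd' {k : ℕ} :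
    Continuous fun X : blockNilpotent n k (AdeleRing (𝓞 K) K) =>
      unipotentOfBlock n k (AdeleRing (𝓞 K) K) (Multiplicative.ofAdd X) := by
  refine Units.continuous_iff.2 ⟨?_, ?_⟩
  · exact continuous_const.add continuous_subtype_val
  · exact continuous_const.sub continuous_subtype_val

/-- **A continuous left-invariant function is bounded along `(1 + X) g e(s)`**: for `ψ` continuous
and left `GL_n(K)`-invariant, `g ∈ GL_n(𝔸_K)` and `X₀ ∈ 𝔤𝔩_n(K_∞)` there is `M` with
`‖ψ ((1 + X) g (exp sX₀, 1))‖ ≤ M` for all `X ∈ 𝔫_k(𝔸_K)` and `|s| ≤ 1` — by periodicity under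
`𝔫_k(K)` it suffices to let `X` range over the closure of Tate's block fundamental domain, which
is compact (`isCompact_closure_blockFundamentalDomain`). [folklore] -/
theorem IsLeftInvariant.exists_forall_norm_apply_glUnipotent_mul_le {k : ℕ}
    {ψ : GL (Fin n) (AdeleRing (𝓞 K) K) → ℂ} (hψc : Continuous ψ)
    (hψ : IsLeftInvariant (AdelicGroupData.gl n K) ψ) (g : GL (Fin n) (AdeleRing (𝓞 K) K))
    (X₀ : (archGroupGL n K).lie) :
    ∃ M : ℝ, ∀ (X : blockNilpotent n k (AdeleRing (𝓞 K) K)) (s : ℝ), s ∈ Icc (-1 : ℝ) 1 →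
      ‖ψ (unipotentOfBlock n k (AdeleRing (𝓞 K) K) (Multiplicative.ofAdd X) * g *
        glArch n K ((archGroupGL n K).expMem (s • X₀)))‖ ≤ M := by
  set f : blockNilpotent n k (AdeleRing (𝓞 K) K) × ℝ → ℂ := fun p =>
    ψ (unipotentOfBlock n k (AdeleRing (𝓞 K) K) (Multiplicative.ofAdd p.1) * g *
      glArch n K ((archGroupGL n K).expMem (p.2 • X₀))) with hf
  have hfc : Continuous f := by
    refine hψc.comp ?_
    refine ((continuous_unipotentOfBlock_ofAdd'.comp continuous_fst).mul continuous_const).mul ?_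
    have h := continuous_mul_glArch_expMem (1 : GL (Fin n) (AdeleRing (𝓞 K) K)) X₀
    simp only [one_mul] at h
    exact h.comp continuous_snd
  have hcpt : IsCompact (closure (blockFundamentalDomain n k K) ×ˢ Icc (-1 : ℝ) 1) :=
    (isCompact_closure_blockFundamentalDomain n k K).prod isCompact_Icc
  obtain ⟨M, hM⟩ := hcpt.exists_bound_of_continuousOn hfc.continuousOn
  refine ⟨M, fun X s hs => ?_⟩
  obtain ⟨γ, hγ⟩ := (existsUnique_vadd_mem_blockFundamentalDomain n k K X).exists
  have hper : ψ (unipotentOfBlock n k (AdeleRing (𝓞 K) K) (Multiplicative.ofAdd X) * g *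
      glArch n K ((archGroupGL n K).expMem (s • X₀))) =
      ψ (unipotentOfBlock n k (AdeleRing (𝓞 K) K) (Multiplicative.ofAdd (γ +ᵥ X)) * g *
        glArch n K ((archGroupGL n K).expMem (s • X₀))) := by
    rw [mul_assoc, mul_assoc, hψ.apply_glUnipotent_vadd_mul γ X]
  rw [hper]
  exact hM (γ +ᵥ X, s) (mk_mem_prod (subset_closure hγ) hs)

end Rational

/-! ### 2. Closure properties of the hypotheses under the word action -/

section Closure

/-- Right invariance under a level passes to iterated Lie derivatives
(`IsRightInvariantUnder.lieDeriv_gl` iterated). [cite: BorelJacquet1979, 4.3 (ii)] -/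
theorem IsRightInvariantUnder.iterLieDeriv_gl {φ : GL (Fin n) (AdeleRing (𝓞 K) K) → ℂ}
    {U : Subgroup (GL (Fin n) (AdeleRing (𝓞 K) K))} (hU : U ∈ finiteLevelsGL n K)
    (hφU : IsRightInvariantUnder U φ) (w : List (archGroupGL n K).lie) :
    IsRightInvariantUnder U (Literature.NumberTheory.Automorphic.iterLieDeriv (glArch n K) w φ) := by
  induction w with
  | nil => exact hφU
  | cons X w ih => exact ih.lieDeriv_gl hU X

/-- Right invariance under a subgroup is preserved by finite linear combinations. [folklore] -/
theorem IsRightInvariantUnder.finset_sum_smul {G : Type*} [Group G] {U : Subgroup G} {J : Type*}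
    (s : Finset J) (c : J → ℂ) {ψ : J → G → ℂ} (hψ : ∀ j, IsRightInvariantUnder U (ψ j)) :
    IsRightInvariantUnder U (∑ j ∈ s, c j • ψ j) := by
  intro u hu g
  simp only [Finset.sum_apply, Pi.smul_apply]
  exact Finset.sum_congr rfl fun j _ => by rw [hψ j u hu g]

/-- Left invariance under a subgroup is preserved by finite linear combinations. [folklore] -/
theorem IsLeftInvariantUnder.finset_sum_smul {G : Type*} [Group G] {V : Subgroup G} {J : Type*}
    (s : Finset J) (c : J → ℂ) {ψ : J → G → ℂ} (hψ : ∀ j, IsLeftInvariantUnder V (ψ j)) :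
    IsLeftInvariantUnder V (∑ j ∈ s, c j • ψ j) := by
  intro v hv g
  simp only [Finset.sum_apply, Pi.smul_apply]
  exact Finset.sum_congr rfl fun j _ => by rw [hψ j v hv g]

/-- The word action as a finite sum over the word basis. [folklore] -/
theorem applyFree_eq_finset_sum {A : Type*} [NormedCommRing A] [NormedAlgebra ℝ A] [NormedAlgebra ℚ A]
    [CompleteSpace A] [StarRing A] {N : Type*} [Fintype N] [DecidableEq N] {H : RealMatrixGroup A N}
    {G : Type*} [Group G] (ι : H.carrier →* G) (p : FreeAlgebra ℝ H.lie) (φ : G → ℂ) :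
    applyFree ι p φ = ∑ w ∈ ((FreeAlgebra.basisFreeMonoid ℝ H.lie).repr p).support,
      (((FreeAlgebra.basisFreeMonoid ℝ H.lie).repr p w : ℝ) : ℂ) •
        iterLieDeriv ι (FreeMonoid.toList w) φ :=
  rfl

/-- Right invariance under a level passes to `p φ` for every `p ∈ ℝ⟨𝔤⟩`.
[cite: BorelJacquet1979, 4.3 (ii)] -/
theorem IsRightInvariantUnder.applyFree_gl {φ : GL (Fin n) (AdeleRing (𝓞 K) K) → ℂ}
    {U : Subgroup (GL (Fin n) (AdeleRing (𝓞 K) K))} (hU : U ∈ finiteLevelsGL n K)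
    (hφU : IsRightInvariantUnder U φ) (p : FreeAlgebra ℝ (archGroupGL n K).lie) :
    IsRightInvariantUnder U (Literature.NumberTheory.Automorphic.applyFree (glArch n K) p φ) := by
  rw [applyFree_eq_finset_sum]
  exact IsRightInvariantUnder.finset_sum_smul _ _ fun w => hφU.iterLieDeriv_gl hU _

/-- Left invariance passes to `p φ` for every `p ∈ ℝ⟨𝔤⟩`. [cite: BorelJacquet1979, 4.3 (ii)] -/
theorem IsLeftInvariantUnder.applyFree_gl {φ : GL (Fin n) (AdeleRing (𝓞 K) K) → ℂ}
    {V : Subgroup (GL (Fin n) (AdeleRing (𝓞 K) K))} (hφ : IsLeftInvariantUnder V φ)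
    (p : FreeAlgebra ℝ (archGroupGL n K).lie) :
    IsLeftInvariantUnder V (Literature.NumberTheory.Automorphic.applyFree (glArch n K) p φ) := by
  rw [applyFree_eq_finset_sum]
  exact IsLeftInvariantUnder.finset_sum_smul _ _ fun w => hφ.iterLieDeriv_gl _

/-- **`(q p) φ = q (p φ)` for smooth `φ`**: on functions smooth in the archimedean variable the
word action of `ℝ⟨𝔤⟩` is multiplicative (it is the algebra action of `U(𝔤)` on `archSmooth`,
`coe_envelopingAction_freeToEnveloping` of `ArchimedeanEnvelopingAction`). Stated for the `GL_n`
datum. Borel–Jacquet 1979, §1.5–1.6. [cite: BorelJacquet1979, §1.6] -/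
theorem applyFree_mul_of_isArchSmooth {φ : GL (Fin n) (AdeleRing (𝓞 K) K) → ℂ}
    (hφ : IsArchSmooth (glArch n K) φ) (q p : FreeAlgebra ℝ (archGroupGL n K).lie) :
    applyFree (glArch n K) (q * p) φ = applyFree (glArch n K) q (applyFree (glArch n K) p φ) := by
  have hH : (archGroupGL n K).lie = ⊤ := rfl
  have hc : (archGroupGL n K).carrier = ⊤ := rfl
  have hp : IsArchSmooth (glArch n K) (applyFree (glArch n K) p φ) :=
    isArchSmooth_applyFree hH hc p hφ
  rw [← coe_envelopingAction_freeToEnveloping hH hc (q * p) ⟨φ, hφ⟩, map_mul, map_mul,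
    Module.End.mul_apply]
  have h1 : (envelopingAction (lieDerivRep (glArch n K) hH hc) (freeToEnveloping _ p) ⟨φ, hφ⟩ :
      archSmooth (glArch n K)) = ⟨applyFree (glArch n K) p φ, hp⟩ :=
    Subtype.ext (coe_envelopingAction_freeToEnveloping hH hc p ⟨φ, hφ⟩)
  rw [h1, coe_envelopingAction_freeToEnveloping hH hc q ⟨_, hp⟩]

end Closure

/-! ### 3. Cuspidality of Lie derivatives -/

section Cusp

/-- **The constant term of `X φ` along `P_k` vanishes with that of `φ`.** Let
`φ : GL_n(𝔸_K) → ℂ` be left `GL_n(K)`-invariant, smooth in the archimedean variable and right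
invariant under an admissible level, with `CuspConditionGL n K φ k`. Then for every
`X ∈ 𝔤𝔩_n(K_∞)` the Lie derivative `X φ` satisfies `CuspConditionGL n K (X φ) k`: for a Haar measure
`ν`, a measurable fundamental domain `𝓕` of `𝔫_k(K)` and `g`, the function
`s ↦ ∫_𝓕 φ ((1 + Y) g (exp sX, 1)) dν(Y)` vanishes identically (the cusp condition at `g (exp sX, 1)`)
and is differentiable at `0` under the integral sign with derivative `∫_𝓕 (X φ)((1 + Y) g) dν(Y)`
— the integrand's `s`-derivative `(X φ)((1 + Y) g (exp sX, 1))` (`IsArchSmooth.hasDerivAt_expMem_smul`)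
is continuous (`continuous_of_isArchSmooth_of_isRightInvariantUnder`) and bounded uniformly in
`Y` and `|s| ≤ 1` (`exists_forall_norm_apply_glUnipotent_mul_le`), and `ν 𝓕 < ∞`
(`IsAddFundamentalDomain.measure_eq` with Tate's domain). Moeglin–Waldspurger I.2.6 ("if `φ` is
smooth then `φ_P` is smooth") and the last sentence of the proof of Lemma I.2.10.
[cite: MoeglinWaldspurger1995, I.2.6 and proof of Lemma I.2.10] -/
theorem CuspConditionGL.lieDeriv {k : ℕ} {φ : GL (Fin n) (AdeleRing (𝓞 K) K) → ℂ}
    (hφ : CuspConditionGL n K φ k) (hleft : IsLeftInvariant (AdelicGroupData.gl n K) φ)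
    (hs : IsArchSmooth (glArch n K) φ) {U : Subgroup (GL (Fin n) (AdeleRing (𝓞 K) K))}
    (hU : U ∈ finiteLevelsGL n K) (hφU : IsRightInvariantUnder U φ) (X₀ : (archGroupGL n K).lie) :
    CuspConditionGL n K (Literature.NumberTheory.Automorphic.lieDeriv (glArch n K) X₀ φ) k := by
  intro ν _ 𝓕 h𝓕 g'
  -- the base point, typed in `GL_n(𝔸_K)`
  obtain ⟨g, rfl⟩ : ∃ g : GL (Fin n) (AdeleRing (𝓞 K) K), g = g' := ⟨g', rfl⟩
  haveI : Countable (rationalBlock n k K) := rationalBlock_countable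
  -- the derivative and its regularity
  set ψ : GL (Fin n) (AdeleRing (𝓞 K) K) → ℂ :=
    Literature.NumberTheory.Automorphic.lieDeriv (glArch n K) X₀ φ with hψ
  have hφc : Continuous φ := continuous_of_isArchSmooth_of_isRightInvariantUnder hs hU hφU
  have hψc : Continuous ψ :=
    continuous_of_isArchSmooth_of_isRightInvariantUnder (hs.lieDeriv_gl X₀) hU (hφU.lieDeriv_gl hU X₀)
  have hψleft : IsLeftInvariant (AdelicGroupData.gl n K) ψ :=
    IsLeftInvariantUnder.lieDeriv_gl (V := (AdelicGroupData.gl n K).arithmeticSubgroup) hleft X₀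
  -- the one-parameter subgroup
  set e : ℝ → GL (Fin n) (AdeleRing (𝓞 K) K) := fun s =>
    glArch n K ((archGroupGL n K).expMem (s • X₀)) with he
  have he0 : e 0 = 1 := by
    simp only [he, RealMatrixGroup.expMem_zero_smul, map_one]
  -- the parametric integrand and its derivative
  set F : ℝ → blockNilpotent n k (AdeleRing (𝓞 K) K) → ℂ := fun s Y =>
    φ (unipotentOfBlock n k (AdeleRing (𝓞 K) K) (Multiplicative.ofAdd Y) * (g * e s)) with hF
  set F' : ℝ → blockNilpotent n k (AdeleRing (𝓞 K) K) → ℂ := fun s Y =>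
    ψ (unipotentOfBlock n k (AdeleRing (𝓞 K) K) (Multiplicative.ofAdd Y) * (g * e s)) with hF'
  have hFc : ∀ s, Continuous (F s) := fun s =>
    hφc.comp (continuous_unipotentOfBlock_ofAdd'.mul continuous_const)
  have hF'c : ∀ s, Continuous (F' s) := fun s =>
    hψc.comp (continuous_unipotentOfBlock_ofAdd'.mul continuous_const)
  -- finiteness of the measure of the fundamental domain
  have h𝓕₀ : IsAddFundamentalDomain (rationalBlock n k K) (blockFundamentalDomain n k K) ν :=
    isAddFundamentalDomain_blockFundamentalDomain n k K ν
  have hfin : ν 𝓕 < ⊤ := by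
    rw [h𝓕.measure_eq h𝓕₀]
    exact measure_blockFundamentalDomain_lt_top n k K ν
  haveI : IsFiniteMeasure (ν.restrict 𝓕) := ⟨by rwa [Measure.restrict_apply_univ]⟩
  -- a uniform bound for the derivative
  obtain ⟨M, hM⟩ := hψleft.exists_forall_norm_apply_glUnipotent_mul_le (k := k) hψc g X₀
  have hbound : ∀ (Y : blockNilpotent n k (AdeleRing (𝓞 K) K)), ∀ s ∈ Icc (-1 : ℝ) 1,
      ‖F' s Y‖ ≤ M := fun Y s hs => by
    simp only [hF', ← mul_assoc]
    exact hM Y s hs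
  -- differentiability of the integrand in the parameter
  have hdiff : ∀ (Y : blockNilpotent n k (AdeleRing (𝓞 K) K)) (s : ℝ),
      HasDerivAt (fun s => F s Y) (F' s Y) s := fun Y s => by
    have h := hs.hasDerivAt_expMem_smul (glArch n K) X₀
      (unipotentOfBlock n k (AdeleRing (𝓞 K) K) (Multiplicative.ofAdd Y) * g) s
    simp only [hF, hF', hψ, he, ← mul_assoc]
    exact h
  -- differentiate under the integral sign
  have key := hasDerivAt_integral_of_dominated_loc_of_deriv_le (μ := ν.restrict 𝓕) (x₀ := (0 : ℝ))
    (F := F) (F' := F') (s := Icc (-1 : ℝ) 1) (bound := fun _ => M)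
    (Icc_mem_nhds (by norm_num) (by norm_num))
    (Eventually.of_forall fun s => (hFc s).aestronglyMeasurable)
    (hφ ν 𝓕 h𝓕 (g * e 0)).1
    (hF'c 0).aestronglyMeasurable
    (Eventually.of_forall fun Y s hs => hbound Y s hs)
    (integrable_const M)
    (Eventually.of_forall fun Y s _ => hdiff Y s)
  obtain ⟨hint, hderiv⟩ := key
  -- the integral vanishes identically, hence so does its derivative
  have hzero : (fun s : ℝ => ∫ Y, F s Y ∂(ν.restrict 𝓕)) = fun _ => 0 :=
    funext fun s => (hφ ν 𝓕 h𝓕 (g * e s)).2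
  rw [hzero] at hderiv
  have hval : ∫ Y, F' 0 Y ∂(ν.restrict 𝓕) = 0 := hderiv.unique (hasDerivAt_const (0 : ℝ) (0 : ℂ))
  have h1 : Integrable (F' 0) (ν.restrict 𝓕) := hint
  simp only [hF', he0, mul_one] at h1 hval
  exact ⟨h1, hval⟩

/-- **Cuspidality of iterated Lie derivatives**: if the constant term of `φ` along `P_k` vanishes,
so does that of `X₁ ⋯ X_m φ` for every word (`CuspConditionGL.lieDeriv` iterated; the hypotheses
are stable, `IsLeftInvariantUnder.iterLieDeriv_gl`, `IsArchSmooth.iterLieDeriv_gl`,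
`IsRightInvariantUnder.iterLieDeriv_gl`). [cite: MoeglinWaldspurger1995, proof of Lemma I.2.10] -/
theorem CuspConditionGL.iterLieDeriv {k : ℕ} {φ : GL (Fin n) (AdeleRing (𝓞 K) K) → ℂ}
    (hφ : CuspConditionGL n K φ k) (hleft : IsLeftInvariant (AdelicGroupData.gl n K) φ)
    (hs : IsArchSmooth (glArch n K) φ) {U : Subgroup (GL (Fin n) (AdeleRing (𝓞 K) K))}
    (hU : U ∈ finiteLevelsGL n K) (hφU : IsRightInvariantUnder U φ) (w : List (archGroupGL n K).lie) :
    CuspConditionGL n K (Literature.NumberTheory.Automorphic.iterLieDeriv (glArch n K) w φ) k := by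
  induction w with
  | nil => exact hφ
  | cons X w ih =>
    rw [iterLieDeriv_cons]
    exact ih.lieDeriv
      (IsLeftInvariantUnder.iterLieDeriv_gl (V := (AdelicGroupData.gl n K).arithmeticSubgroup) hleft w)
      (hs.iterLieDeriv_gl w) hU (hφU.iterLieDeriv_gl hU w) X

/-- **Cuspidality of `p φ`**: if the constant term of `φ` along `P_k` vanishes, so does that of
`p φ` for every non-commutative polynomial `p ∈ ℝ⟨𝔤⟩` (a finite linear combination of iterated
Lie derivatives; `CuspConditionGL.add`, `.smul`). This is the reduction "replace `φ` by `δ(X)φ`"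
closing the proof of Moeglin–Waldspurger's Lemma I.2.10, in the cuspidal case.
[cite: MoeglinWaldspurger1995, proof of Lemma I.2.10] -/
theorem CuspConditionGL.applyFree {k : ℕ} {φ : GL (Fin n) (AdeleRing (𝓞 K) K) → ℂ}
    (hφ : CuspConditionGL n K φ k) (hleft : IsLeftInvariant (AdelicGroupData.gl n K) φ)
    (hs : IsArchSmooth (glArch n K) φ) {U : Subgroup (GL (Fin n) (AdeleRing (𝓞 K) K))}
    (hU : U ∈ finiteLevelsGL n K) (hφU : IsRightInvariantUnder U φ)
    (p : FreeAlgebra ℝ (archGroupGL n K).lie) :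
    CuspConditionGL n K (Literature.NumberTheory.Automorphic.applyFree (glArch n K) p φ) k := by
  rw [applyFree_eq_finset_sum]
  induction ((FreeAlgebra.basisFreeMonoid ℝ (archGroupGL n K).lie).repr p).support using
    Finset.induction_on with
  | empty =>
    rw [Finset.sum_empty]
    exact CuspConditionGL.zero k
  | insert w s hw ih =>
    rw [Finset.sum_insert hw]
    exact (CuspConditionGL.smul _ (hφ.iterLieDeriv hleft hs hU hφU _)).add ih

end Cusp

end Literature.NumberTheory.Automorphic
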